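import Summits.QuantumFields.YangMills.Theorems.UnitScaleTiltHistoryTailHaarForest

/-!
# E6′ ON FORESTS, PACKAGED: along a leaf-elimination order the coarse bond variables of EVERY covariant averaging are EXACT product Haar

Support file for `Summit.QuantumFields.YangMills.Theses.UnitScaleTilt.HistoryTailL` (stmt-QuantumFields-19936; fleet unit ym-ust-18916-p1 g4; finding F-g4-1
§1 as adopted by OWNER RULING g18-№3 §2: «E6′ for `blockAvg ℰp`: forests exact»).  `…Theorems.HaarForest` proved the single-bond identity and the LEAF-STRIPPING
step; this file runs the induction: for a finite family of coarse bonds `e : Fin n → PBond P (j+1)` listed in a LEAF-ELIMINATION ORDER (every bond has an endpoint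
met by none of the LATER bonds — every forest admits such an order, and a family admitting one is a forest), the joint law of `(Ū(e i))_i` under `dU` is
`⊗_{Fin n} haar` (`map_avg_family_eq_pi_haar`), for every `av : Averaging P j G` with measurable `avg`, standing range, bi-invariant probability `HaarData`.
Instance: the pinned (0.4)/`ℰp` averaging of a `T3Family` (`T3.map_blockAvg_family_eq_pi_haar`).  Elementary ([folklore] + [Balaban1985Averaging] (11) p.19
covariance); decides nothing about cycles (`HaarFibreDefect`, finding §3); not a claim about the mass gap.  No `sorry`, no definitions, standard axioms.
-/

noncomputable section

namespace Summit.QuantumFields.YangMills.Theorems.HaarForest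

open _root_.MeasureTheory
open Literature.MathematicalPhysics.QuantumFieldTheory.Balaban1983to89

section Induction

variable {P : Params} {j : ℕ} {G : Type*} [GaugeGroup G] [MeasurableSpace G] [HaarData G] [MeasurableMul₂ G]
variable (hj : j + 1 ≤ P.m + P.K) (av : Averaging P j G) (hav : Measurable av.avg)
include hj hav

/-- **LEAF-ELIMINATION ORDER ⇒ EXACT PRODUCT HAAR.**  If every bond `e i` has an endpoint (`src` or `tgt`) that is an endpoint of no later bond `e i'`, `i < i'`,
then the joint law of the coarse bond variables `(Ū(e i))_{i : Fin n}` under product Haar `dU` is `⊗ haar`. [cite: Balaban1985Averaging, (11) p.19] -/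
theorem map_avg_family_eq_pi_haar : ∀ (n : ℕ) (e : Fin n → PBond P (j+1)),
    (∀ i : Fin n, (∀ i' : Fin n, i < i' → (e i').src ≠ (e i).src ∧ (e i').tgt ≠ (e i).src) ∨
                 (∀ i' : Fin n, i < i' → (e i').src ≠ (e i).tgt ∧ (e i').tgt ≠ (e i).tgt)) →
    (fieldMeasure P j G).map (fun U i => av.avg U (e i)) = Measure.pi fun _ : Fin n => (HaarData.haar : Measure G)
  | 0, e, _ => by
    have hmeas : Measurable (fun (U : GaugeField P j G) (i : Fin 0) => av.avg U (e i)) := measurable_pi_lambda _ fun i => i.elim0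
    haveI : IsProbabilityMeasure ((fieldMeasure P j G).map (fun U (i : Fin 0) => av.avg U (e i))) :=
      Measure.isProbabilityMeasure_map hmeas.aemeasurable
    refine (Measure.pi_eq fun s _ => ?_).symm
    rw [Finset.univ_eq_empty, Finset.prod_empty]
    have : (Set.univ.pi s : Set (Fin 0 → G)) = Set.univ := Set.eq_univ_of_forall fun f i => i.elim0
    rw [this, measure_univ]
  | n + 1, e, hleaf => by
    -- the tail family and its leaf order
    have htail := map_avg_family_eq_pi_haar n (fun i => e i.succ) fun i => by
      rcases hleaf i.succ with h | h
      · exact Or.inl fun i' hi' => h i'.succ (Fin.succ_lt_succ_iff.mpr hi')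
      · exact Or.inr fun i' hi' => h i'.succ (Fin.succ_lt_succ_iff.mpr hi')
    -- strip the leaf `e 0`
    have hpair : (fieldMeasure P j G).map (fun U => (av.avg U (e 0), fun i : Fin n => av.avg U (e i.succ))) =
        (HaarData.haar : Measure G).prod (Measure.pi fun _ : Fin n => (HaarData.haar : Measure G)) := by
      rcases hleaf 0 with h | h
      · rw [map_avg_pair_eq_haar_prod_of_forall_ne_src hj av hav (e 0) (fun i : Fin n => e i.succ)
          (fun i => h i.succ (Fin.succ_pos i)), htail]
      · rw [map_avg_pair_eq_haar_prod_of_forall_ne_tgt hj av hav (e 0) (fun i : Fin n => e i.succ)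
          (fun i => h i.succ (Fin.succ_pos i)), htail]
    -- reassemble along `Fin (n+1) ≃ᵐ G × Fin n`
    set Φ := MeasurableEquiv.piFinSuccAbove (fun _ : Fin (n + 1) => G) 0 with hΦdef
    have hΦ : MeasurePreserving Φ (Measure.pi fun _ : Fin (n + 1) => (HaarData.haar : Measure G))
        ((HaarData.haar : Measure G).prod (Measure.pi fun _ : Fin n => (HaarData.haar : Measure G))) := by
      exact measurePreserving_piFinSuccAbove (fun _ : Fin (n + 1) => (HaarData.haar : Measure G)) 0
    have hfam : Measurable (fun (U : GaugeField P j G) (i : Fin (n + 1)) => av.avg U (e i)) :=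
      measurable_pi_lambda _ fun i => (show Measurable fun V : GaugeField P (j+1) G => V (e i) from measurable_pi_apply _).comp hav
    have hcomp : Φ ∘ (fun (U : GaugeField P j G) (i : Fin (n + 1)) => av.avg U (e i)) =
        fun U => (av.avg U (e 0), fun i : Fin n => av.avg U (e i.succ)) := by
      funext U
      simp [hΦdef, MeasurableEquiv.piFinSuccAbove, Fin.insertNthEquiv]
      rfl
    have key : ((fieldMeasure P j G).map (fun U i => av.avg U (e i))).map Φ =
        (HaarData.haar : Measure G).prod (Measure.pi fun _ : Fin n => (HaarData.haar : Measure G)) := by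
      rw [Measure.map_map Φ.measurable hfam, hcomp, hpair]
    calc (fieldMeasure P j G).map (fun U i => av.avg U (e i))
        = (((fieldMeasure P j G).map (fun U i => av.avg U (e i))).map Φ).map Φ.symm := by
          rw [Measure.map_map Φ.symm.measurable Φ.measurable, MeasurableEquiv.symm_comp_self, Measure.map_id]
      _ = ((HaarData.haar : Measure G).prod (Measure.pi fun _ : Fin n => (HaarData.haar : Measure G))).map Φ.symm := by rw [key]
      _ = Measure.pi fun _ : Fin (n + 1) => (HaarData.haar : Measure G) := hΦ.symm.map_eq

end Induction

/-! ## The pinned averaging of the `T3Family` -/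

namespace T3

open Literature.MathematicalPhysics.QuantumFieldTheory.Balaban1983to89.T3ContinuumYM3Torus
open Literature.MathematicalPhysics.QuantumFieldTheory.Balaban1983to89.T3UnitLawDensityEML (ℰp measurable_blockAvg)

/-- **FOREST SHADOW OF `HaarCompatT3 F`, PACKAGED**: along any leaf-elimination order the coarse bond variables of Bałaban's (0.4)/`ℰp` block averaging are
exactly independent Haar on `SU(2)`, at every level of the standing range of every approximation. [cite: Balaban1985Averaging, (11) p.19] -/
theorem map_blockAvg_family_eq_pi_haar (F : T3Family) (K j : ℕ) (hj : j + 1 ≤ F.m + K) (n : ℕ) (e : Fin n → PBond (F.P K) (j + 1))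
    (hleaf : ∀ i : Fin n, (∀ i' : Fin n, i < i' → (e i').src ≠ (e i).src ∧ (e i').tgt ≠ (e i).src) ∨
                          (∀ i' : Fin n, i < i' → (e i').src ≠ (e i).tgt ∧ (e i').tgt ≠ (e i).tgt)) :
    (fieldMeasure (F.P K) j (Matrix.specialUnitaryGroup (Fin 2) ℂ)).map
        (fun U i => (BlockAveraging.blockAvg (P := F.P K) (j := j) ℰp).avg U (e i)) =
      Measure.pi fun _ : Fin n => (HaarData.haar : Measure (Matrix.specialUnitaryGroup (Fin 2) ℂ)) :=
  map_avg_family_eq_pi_haar (P := F.P K) hj _ (measurable_blockAvg F K j) n e hleaf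

end T3

end Summit.QuantumFields.YangMills.Theorems.HaarForest

end
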